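import Mathlib.LinearAlgebra.Lagrange
import Mathlib.Algebra.Polynomial.Roots
import Mathlib.RingTheory.Polynomial.Pochhammer
import Summits.ABC.ABC.Theorems.TowerFourSubLiouville.Negative.PadeTableThree

/-!
# `TowerFourSubLiouville` (stmt-ABC-1649): the `[z/z]` Padé pair of the FOURTH ROOT for EVERY `z` — an extremal fewnomial,
by Lagrange interpolation (no hypergeometrics)

Negative-side module of the standing disprover (cycle 17, refuter-cdisprove-stmt-ABC-1649-g17-0, 2026-08-17), the general-`z` core behind
`Negative.CriticalLineStep` (`z = 1, 2`) and `Negative.PadeTableThree` / `Negative.CriticalLineTwoNineteenths` (`z = 3`): there the step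
polynomials `A_z, B_z` with `(N + a)·A_z⁴ − N·B_z⁴ = a^{2z+1}·E_z` were produced one `z` at a time (`ring`), and the GENERAL step — which would put a
FALSE lobe of the two-exponent diagram at EVERY line point `(2/(6z+1), 12z/(6z+1))` and empty the open Dirichlet-edge segment `{0 < θ < 2/19, φ = 2}`
— was recorded as needing "the hypergeometric `₂F₁` Padé family formalised" (Disproof.lean (16d), (17c)).  It does not.

THE OBSERVATION.  Write the Padé condition for `⁴√·` through `u = X⁴`: `X·p(X⁴) − q(X⁴)` is a FEWNOMIAL `Σ_{e ∈ S_z} c_e X^e` on the `2z + 2`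
exponents `S_z = {1, 5, …, 4z+1} ∪ {0, 4, …, 4z}`, and `u·p(u)⁴ − q(u)⁴` vanishes to order `2z + 1` at `u = 1` iff the fewnomial vanishes to order
`2z + 1 = #S_z − 1` at `X = 1` (`fourthRoot_transfer`: `P − Q ∣ P⁴ − Q⁴`, and the multiplicity of the root `1` does not change under `u = X⁴` in
characteristic `0`).  A fewnomial on `#S` exponents vanishing to order `#S − 1` at `1` is UNIQUE up to scale and EXPLICIT: its coefficients are the
top-order divided-difference weights `c_e = 1/∏_{e' ∈ S∖{e}} (e − e')` (Lagrange: `Σ_e f(e)·c_e = 0` for every polynomial `f` of degree `≤ #S − 2`,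
`sum_eval_mul_inv_prod_sub_eq_zero`, from `Lagrange.eq_interpolate` and `Lagrange.leadingCoeff_basis`; applied to `f = binom(·, m)`, `m ≤ 2z`, after
expanding `X^e = Σ_m binom(e,m)(X−1)^m`: `padeFewnomial_dvd`).  Hence, for every `z`:

  **`(X − 1)^{2z+1} ∣ X·p_z(X)⁴ − q_z(X)⁴`,  `p_z = Σ_{i ≤ z} c_{4i+1} X^i`,  `q_z = −Σ_{i ≤ z} c_{4i} X^i`**   (`padeQuartic_dvd`),

`c_e = (∏_{e' ∈ S_z∖{e}} (e − e'))⁻¹` — the `[z/z]` Padé pair of `(1 + x)^{1/4}` in closed form (`exists_padePair`: `deg ≤ z`, `p_z ≠ 0`).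
Seat check (folder `py/fewnomial.py`): up to scale `(p_z, q_z)` IS the pair `(A_z(Y,1), A_z(1,Y))` of the landed steps — `z = 1`: `(3Y+5, 5Y+3)/60`
(`Y(3Y+5)⁴ − (5Y+3)⁴ = (Y−1)³(81Y²+158Y+81)`, example below); `z = 2`: `(7Y²+42Y+15, 15Y²+42Y+7)`; `z = 3`: `(77Y³+1001Y²+1287Y+195, reversed)`
(`77·(13·12·9·8·5·4·1) = 1001·(9·8·5·4·1·3·4) = 1287·(5·4·1·3·4·7·8) = 195·(1·3·4·7·8·11·12) = 17297280`, example below) — and `q_z` is the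
REVERSAL of `p_z` (the involution `e ↦ 4z+1−e` of `S_z` flips the sign of `c_e`), i.e. `B_z(u,v) = A_z(v,u)`.

ARITHMETIC OF THE WEIGHTS (seat, on paper + `py/fewnomial3.py` to `z = 200`): all `c_{4i+1} > 0` (the number of larger nodes is even); the primitive
integer vector `(a_0, …, a_z) ∝ (c_{4i+1})` has `a_i/a_z = binom(z,i)·∏_{i<k≤z}(4k+1)/∏_{1≤k≤z−i}(4k−1)`, and the top coefficient `a_z = A_z(1,0)` — whose
primes are exactly the FATAL coprimality obstructions of the step families (a prime dividing `a_z` and the coefficient `v` or `w`) — is ODD and has NO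
prime factor `≡ 1 (mod 4)` (floor-function comparison of the `p`-adic valuations of the two arithmetic progressions plus Kummer; in particular `5 ∤ a_z`,
so the `d = 3` Pell–Bezout base, on which `5 ∣ v` always, is never fatally obstructed).  What remains for the general lobe theorem is bookkeeping:
integer scaling, the sign lemma, the class `s ≡ 1 (mod 9∏_{p ∣ a_z} p)`, dividing `gcd(Y, Z)` out, growth — recorded in Disproof.lean § (17d).
Calibration, not a kill.
-/

-- `Summit.ABC.ABC` is the mandated summit-side namespace (CONVENTIONS §2); the duplicate is deliberate.
set_option linter.dupNamespace false

namespace Summit.ABC.ABC.Theorems.TowerFourSubLiouville.Negative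

open Polynomial Finset

/-! ## Two general polynomial lemmas -/

/-- **Top-order divided differences annihilate low-degree polynomials**: for nodes `v i` (`i ∈ s`, injective) and `deg f ≤ #s − 2`,
`Σ_{i ∈ s} f(v i)/∏_{j ≠ i}(v i − v j) = 0` (the `X^{#s−1}`-coefficient of the Lagrange interpolant of `f`, which is `f` itself). -/
theorem sum_eval_mul_inv_prod_sub_eq_zero {F : Type*} [Field F] {ι : Type*} [DecidableEq ι]
    (s : Finset ι) (v : ι → F) (hvs : Set.InjOn v s) (f : F[X]) (hf : f.natDegree + 2 ≤ #s) :
    ∑ i ∈ s, f.eval (v i) * (∏ j ∈ s.erase i, (v i - v j))⁻¹ = 0 := by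
  have hdeg : f.degree < #s := by
    refine lt_of_le_of_lt degree_le_natDegree ?_
    exact_mod_cast (by omega : f.natDegree < #s)
  have key := Lagrange.eq_interpolate (s := s) (v := v) hvs hdeg
  have hc : f.coeff (#s - 1) = 0 := coeff_eq_zero_of_natDegree_lt (by omega)
  rw [key, Lagrange.interpolate_apply, finsetSum_coeff] at hc
  simp only [coeff_C_mul] at hc
  have hb : ∀ i ∈ s, (Lagrange.basis s v i).coeff (#s - 1) = (∏ j ∈ s.erase i, (v i - v j))⁻¹ := by
    intro i hi
    rw [← Lagrange.natDegree_basis hvs hi, coeff_natDegree, Lagrange.leadingCoeff_basis hvs hi]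
  rw [Finset.sum_congr rfl (fun i hi => by rw [hb i hi])] at hc
  exact hc

/-- **Fourth-root transfer**: `(X − 1)^k ∣ X·p(X⁴) − q(X⁴) ⟹ (X − 1)^k ∣ X·p⁴ − q⁴` (over `ℚ`): `P − Q ∣ P⁴ − Q⁴ = r(X⁴)` for `r = Xp⁴ − q⁴`,
and since `X⁴ − 1 = (X − 1)(X³ + X² + X + 1)` with the second factor `= 4 ≠ 0` at `1`, the root `1` has the same multiplicity in `r(X⁴)` as in `r`. -/
theorem fourthRoot_transfer {p q : ℚ[X]} {k : ℕ}
    (h : (X - C 1) ^ k ∣ X * p.comp (X ^ 4) - q.comp (X ^ 4)) :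
    (X - C 1) ^ k ∣ X * p ^ 4 - q ^ 4 := by
  set r : ℚ[X] := X * p ^ 4 - q ^ 4 with hr
  by_cases hr0 : r = 0
  · rw [hr0]; exact dvd_zero _
  have hcomp : r.comp (X ^ 4) = (X * p.comp (X ^ 4)) ^ 4 - (q.comp (X ^ 4)) ^ 4 := by
    rw [hr, sub_comp, mul_comp, X_comp, pow_comp, pow_comp]; ring
  have hdvd1 : (X - C 1) ^ k ∣ r.comp (X ^ 4) := by
    rw [hcomp]
    exact h.trans (sub_dvd_pow_sub_pow _ _ 4)
  obtain ⟨r₁, hr₁, hndvd⟩ := exists_eq_pow_rootMultiplicity_mul_and_not_dvd r hr0 1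
  set j := rootMultiplicity 1 r with hj
  have hfac : (X : ℚ[X]) ^ 4 - C 1 = (X - C 1) * (X ^ 3 + X ^ 2 + X + 1) := by
    rw [map_one]; ring
  have hcomp2 : r.comp (X ^ 4) = ((X ^ 3 + X ^ 2 + X + 1) ^ j * r₁.comp (X ^ 4)) * (X - C 1) ^ j := by
    conv_lhs => rw [hr₁]
    rw [mul_comp, pow_comp, sub_comp, X_comp, C_comp, hfac, mul_pow]; ring
  have hcof1 : ((X ^ 3 + X ^ 2 + X + 1) ^ j * r₁.comp (X ^ 4)).eval 1 ≠ 0 := by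
    rw [eval_mul, eval_pow, eval_comp]
    norm_num
    intro h1
    exact hndvd (dvd_iff_isRoot.mpr h1)
  have hcof0 : (X ^ 3 + X ^ 2 + X + 1) ^ j * r₁.comp (X ^ 4) ≠ 0 := by
    intro h0; rw [h0, eval_zero] at hcof1; exact hcof1 rfl
  have hmult : rootMultiplicity 1 (r.comp (X ^ 4)) = j := by
    rw [hcomp2, rootMultiplicity_mul_X_sub_C_pow hcof0, rootMultiplicity_eq_zero (by exact hcof1), zero_add]
  have hne : r.comp (X ^ 4) ≠ 0 := by
    rw [hcomp2]; exact mul_ne_zero hcof0 (pow_ne_zero _ (X_sub_C_ne_zero 1))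
  have hk : k ≤ j := by
    rw [← hmult]
    exact (le_rootMultiplicity_iff hne).mpr hdvd1
  exact (pow_dvd_pow _ hk).trans (pow_rootMultiplicity_dvd r 1)


/-! ## The node set `S_z = {4i + 1 : i ≤ z} ∪ {4i : i ≤ z}` and its top-order divided differences -/

/-- `#S_z = 2z + 2`. -/
theorem padeNodes_card (z : ℕ) :
    #((range (z + 1)).image (fun i => 4 * i + 1) ∪ (range (z + 1)).image (fun i => 4 * i)) = 2 * z + 2 := by
  rw [card_union_of_disjoint]
  · rw [card_image_of_injective _ (fun a b h => by simpa using h),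
      card_image_of_injective _ (fun a b h => by simpa using h), card_range]
    ring
  · rw [Finset.disjoint_left]
    intro e h1 h2
    simp only [mem_image, mem_range] at h1 h2
    obtain ⟨i, -, rfl⟩ := h1
    obtain ⟨j, -, hj⟩ := h2
    omega

/-- The nodes are `≤ 4z + 1`. -/
theorem padeNodes_le (z e : ℕ)
    (he : e ∈ (range (z + 1)).image (fun i => 4 * i + 1) ∪ (range (z + 1)).image (fun i => 4 * i)) :
    e ≤ 4 * z + 1 := by
  simp only [mem_union, mem_image, mem_range] at he
  rcases he with ⟨i, hi, rfl⟩ | ⟨i, hi, rfl⟩ <;> omega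

/-- **The Lagrange weights of `S_z` kill `e ↦ binom(e, m)` for every `m ≤ 2z`.** -/
theorem padeNodes_sum_inv_prod_mul_choose (z m : ℕ) (hm : m ≤ 2 * z) :
    ∑ e ∈ (range (z + 1)).image (fun i => 4 * i + 1) ∪ (range (z + 1)).image (fun i => 4 * i),
      (∏ e' ∈ ((range (z + 1)).image (fun i => 4 * i + 1) ∪ (range (z + 1)).image (fun i => 4 * i)).erase e,
        (((e : ℕ) : ℚ) - ((e' : ℕ) : ℚ)))⁻¹ * (e.choose m : ℚ) = 0 := by
  set S := (range (z + 1)).image (fun i => 4 * i + 1) ∪ (range (z + 1)).image (fun i => 4 * i) with hS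
  have hcard : #S = 2 * z + 2 := padeNodes_card z
  set f : ℚ[X] := C ((m.factorial : ℚ)⁻¹) * descPochhammer ℚ m with hf
  have hfdeg : f.natDegree + 2 ≤ #S := by
    have : f.natDegree ≤ m := (natDegree_C_mul_le _ _).trans (by rw [descPochhammer_natDegree])
    omega
  have hinj : Set.InjOn (fun n : ℕ => (n : ℚ)) S := Nat.cast_injective.injOn
  have key := sum_eval_mul_inv_prod_sub_eq_zero S (fun n : ℕ => (n : ℚ)) hinj f hfdeg
  have hev : ∀ e : ℕ, f.eval (e : ℚ) = (e.choose m : ℚ) := by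
    intro e
    rw [hf, eval_mul, eval_C, descPochhammer_eval_eq_descFactorial, Nat.descFactorial_eq_factorial_mul_choose]
    have : (m.factorial : ℚ) ≠ 0 := by exact_mod_cast m.factorial_ne_zero
    push_cast
    field_simp
  simp only [hev] at key
  simpa [mul_comm] using key


/-! ## The extremal fewnomial and the general Padé identity -/

/-- **The fewnomial `Σ_{e ∈ S_z} c_e X^e`, `c_e = 1/∏_{e' ≠ e}(e − e')`, vanishes to order `2z + 1` at `X = 1`.** -/
theorem padeFewnomial_dvd (z : ℕ) :
    (X - C 1) ^ (2 * z + 1) ∣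
      ∑ e ∈ (range (z + 1)).image (fun i => 4 * i + 1) ∪ (range (z + 1)).image (fun i => 4 * i),
        C ((∏ e' ∈ ((range (z + 1)).image (fun i => 4 * i + 1) ∪ (range (z + 1)).image (fun i => 4 * i)).erase e,
          (((e : ℕ) : ℚ) - ((e' : ℕ) : ℚ)))⁻¹) * X ^ e := by
  set S := (range (z + 1)).image (fun i => 4 * i + 1) ∪ (range (z + 1)).image (fun i => 4 * i) with hS
  set c : ℕ → ℚ := fun e => (∏ e' ∈ S.erase e, (((e : ℕ) : ℚ) - ((e' : ℕ) : ℚ)))⁻¹ with hc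
  have hX : ∀ e ∈ S, (X : ℚ[X]) ^ e = ∑ m ∈ range (4 * z + 2), C ((e.choose m : ℚ)) * (X - C 1) ^ m := by
    intro e he
    have hle : e ≤ 4 * z + 1 := padeNodes_le z e he
    have h1 : (X : ℚ[X]) = (X - C 1) + C 1 := by ring
    conv_lhs => rw [h1, add_pow]
    rw [Finset.sum_subset (Finset.range_subset_range.mpr (by omega : e + 1 ≤ 4 * z + 2))]
    · refine Finset.sum_congr rfl (fun m _ => ?_)
      rw [map_one, one_pow, mul_one, map_natCast, mul_comm]
    · intro m hm hnot
      simp only [mem_range, not_lt] at hm hnot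
      rw [Nat.choose_eq_zero_of_lt (by omega), Nat.cast_zero, mul_zero]
  have hexp : ∑ e ∈ S, C (c e) * X ^ e
      = ∑ m ∈ range (4 * z + 2), (X - C 1) ^ m * C (∑ e ∈ S, c e * (e.choose m : ℚ)) := by
    rw [Finset.sum_congr rfl (fun e he => by rw [hX e he])]
    simp_rw [Finset.mul_sum]
    rw [Finset.sum_comm]
    refine Finset.sum_congr rfl (fun m _ => ?_)
    rw [map_sum, Finset.mul_sum]
    refine Finset.sum_congr rfl (fun e _ => ?_)
    rw [map_mul]; ring
  rw [hexp]
  apply Finset.dvd_sum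
  intro m hm
  by_cases hm2 : m ≤ 2 * z
  · have h0 : ∑ e ∈ S, c e * (e.choose m : ℚ) = 0 := padeNodes_sum_inv_prod_mul_choose z m hm2
    rw [h0, map_zero, mul_zero]
    exact dvd_zero _
  · exact Dvd.dvd.mul_right (pow_dvd_pow _ (by omega)) _

/-- Splitting a fewnomial on `S_z` by residues mod `4`: `Σ_{e ∈ S_z} c_e X^e = X·p(X⁴) − q(X⁴)` with `p = Σ_{i ≤ z} c_{4i+1} X^i`,
`q = −Σ_{i ≤ z} c_{4i} X^i` (any coefficients `c`). -/
theorem padeFewnomial_eq (z : ℕ) (c : ℕ → ℚ) :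
    ∑ e ∈ (range (z + 1)).image (fun i => 4 * i + 1) ∪ (range (z + 1)).image (fun i => 4 * i), C (c e) * X ^ e
      = X * (∑ i ∈ range (z + 1), C (c (4 * i + 1)) * X ^ i).comp (X ^ 4)
        - (∑ i ∈ range (z + 1), C (-c (4 * i)) * X ^ i).comp (X ^ 4) := by
  rw [Finset.sum_union, Finset.sum_image, Finset.sum_image]
  · rw [Polynomial.sum_comp, Polynomial.sum_comp, Finset.mul_sum, sub_eq_add_neg, ← Finset.sum_neg_distrib]
    congr 1
    · refine Finset.sum_congr rfl (fun i _ => ?_)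
      rw [mul_comp, C_comp, X_pow_comp, pow_succ, pow_mul]; ring
    · refine Finset.sum_congr rfl (fun i _ => ?_)
      rw [mul_comp, C_comp, X_pow_comp, pow_mul, map_neg]; ring
  · intro a _ b _ h; simpa using h
  · intro a _ b _ h; simpa using h
  · rw [Finset.disjoint_left]
    intro e h1 h2
    simp only [mem_image, mem_range] at h1 h2
    obtain ⟨i, -, rfl⟩ := h1
    obtain ⟨j, -, hj⟩ := h2
    omega

/-- **The `[z/z]` Padé identity of the fourth root, for EVERY `z`, in closed form**: with the Lagrange weights `c_e = 1/∏_{e' ∈ S_z∖{e}}(e − e')`,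
`p_z = Σ_{i ≤ z} c_{4i+1} X^i`, `q_z = −Σ_{i ≤ z} c_{4i} X^i`:  `(X − 1)^{2z+1} ∣ X·p_z⁴ − q_z⁴`. -/
theorem padeQuartic_dvd (z : ℕ) :
    (X - C 1) ^ (2 * z + 1) ∣
      X * (∑ i ∈ range (z + 1),
            C ((∏ e' ∈ ((range (z + 1)).image (fun i => 4 * i + 1) ∪ (range (z + 1)).image (fun i => 4 * i)).erase (4 * i + 1),
                (((4 * i + 1 : ℕ) : ℚ) - ((e' : ℕ) : ℚ)))⁻¹) * X ^ i) ^ 4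
        - (∑ i ∈ range (z + 1),
            C (-(∏ e' ∈ ((range (z + 1)).image (fun i => 4 * i + 1) ∪ (range (z + 1)).image (fun i => 4 * i)).erase (4 * i),
                (((4 * i : ℕ) : ℚ) - ((e' : ℕ) : ℚ)))⁻¹) * X ^ i) ^ 4 := by
  apply fourthRoot_transfer
  have h := padeFewnomial_dvd z
  rw [padeFewnomial_eq z (fun e => (∏ e' ∈ ((range (z + 1)).image (fun i => 4 * i + 1) ∪
      (range (z + 1)).image (fun i => 4 * i)).erase e, (((e : ℕ) : ℚ) - ((e' : ℕ) : ℚ)))⁻¹)] at h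
  exact h

/-- The Lagrange weights are nonzero. -/
theorem padeWeight_ne_zero (z e : ℕ) :
    (∏ e' ∈ ((range (z + 1)).image (fun i => 4 * i + 1) ∪ (range (z + 1)).image (fun i => 4 * i)).erase e,
        (((e : ℕ) : ℚ) - ((e' : ℕ) : ℚ)))⁻¹ ≠ 0 := by
  refine inv_ne_zero (Finset.prod_ne_zero_iff.mpr (fun e' he' => ?_))
  have hne : e' ≠ e := Finset.ne_of_mem_erase he'
  have : ((e : ℕ) : ℚ) ≠ ((e' : ℕ) : ℚ) := by exact_mod_cast hne.symm
  exact sub_ne_zero.mpr this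

/-- **Padé pairs of every order for `⁴√` (existential form)**: polynomials `p, q ∈ ℚ[X]` of degree `≤ z`, `p ≠ 0`, with
`(X − 1)^{2z+1} ∣ X·p⁴ − q⁴` — the vanishing order `2z + 1` that makes the step families of the critical line land ON `θ + φ = 2`. -/
theorem exists_padePair (z : ℕ) :
    ∃ p q : ℚ[X], p.natDegree ≤ z ∧ q.natDegree ≤ z ∧ p ≠ 0 ∧ (X - C 1) ^ (2 * z + 1) ∣ X * p ^ 4 - q ^ 4 := by
  set S := (range (z + 1)).image (fun i => 4 * i + 1) ∪ (range (z + 1)).image (fun i => 4 * i) with hS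
  set c : ℕ → ℚ := fun e => (∏ e' ∈ S.erase e, (((e : ℕ) : ℚ) - ((e' : ℕ) : ℚ)))⁻¹ with hc
  refine ⟨∑ i ∈ range (z + 1), C (c (4 * i + 1)) * X ^ i, ∑ i ∈ range (z + 1), C (-c (4 * i)) * X ^ i, ?_, ?_, ?_, ?_⟩
  · refine natDegree_sum_le_of_forall_le _ _ (fun i hi => ?_)
    refine (natDegree_C_mul_le _ _).trans ?_
    rw [natDegree_X_pow]
    exact Nat.lt_succ_iff.mp (mem_range.mp hi)
  · refine natDegree_sum_le_of_forall_le _ _ (fun i hi => ?_)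
    refine (natDegree_C_mul_le _ _).trans ?_
    rw [natDegree_X_pow]
    exact Nat.lt_succ_iff.mp (mem_range.mp hi)
  · intro h0
    have hcoeff := congrArg (fun f : ℚ[X] => f.coeff z) h0
    simp only [finsetSum_coeff, coeff_C_mul_X_pow, coeff_zero] at hcoeff
    rw [Finset.sum_eq_single z (fun i _ hi => if_neg (Ne.symm hi)) (fun h => absurd (mem_range.mpr (Nat.lt_succ_self z)) h),
      if_pos rfl] at hcoeff
    exact padeWeight_ne_zero z (4 * z + 1) hcoeff
  · exact padeQuartic_dvd z

/-- `z = 1`: the weights are `c₁ = 1/12`, `c₅ = 1/20`, `c₀ = −1/20`, `c₄ = −1/12`, i.e. `(p₁, q₁) = (3X + 5, 5X + 3)/60` — the landed `(A₁, B₁)`;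
the Padé identity of order `3`. -/
example : (X : ℚ[X]) * (C (3 : ℚ) * X + C 5) ^ 4 - (C (5 : ℚ) * X + C 3) ^ 4 = (X - C 1) ^ 3 * (C 81 * X ^ 2 + C 158 * X + C 81) := by
  simp only [map_ofNat, map_one]
  ring

/-- `z = 3`: the weights reproduce `A₃ = 77u³ + 1001u²v + 1287uv² + 195v³` of `padeStep₃_identity` (in `(u, v) = (N + a, N)`):
`77·∏_{e'≠13}(13−e') = 1001·∏_{e'≠9}(9−e') = 1287·∏_{e'≠5}(5−e') = 195·∏_{e'≠1}(1−e')` on `S₃ = {0,1,4,5,8,9,12,13}`. -/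
example : (77 : ℤ) * ((13-0)*(13-1)*(13-4)*(13-5)*(13-8)*(13-9)*(13-12)) = 1001 * ((9-0)*(9-1)*(9-4)*(9-5)*(9-8)*(9-12)*(9-13)) ∧
    (1001 : ℤ) * ((9-0)*(9-1)*(9-4)*(9-5)*(9-8)*(9-12)*(9-13)) = 1287 * ((5-0)*(5-1)*(5-4)*(5-8)*(5-9)*(5-12)*(5-13)) ∧
    (1287 : ℤ) * ((5-0)*(5-1)*(5-4)*(5-8)*(5-9)*(5-12)*(5-13)) = 195 * ((1-0)*(1-4)*(1-5)*(1-8)*(1-9)*(1-12)*(1-13)) := by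
  norm_num

example (N a : ℤ) : 2560 * N ^ 3 + 3520 * N ^ 2 * a + 1232 * N * a ^ 2 + 77 * a ^ 3
    = 77 * (N + a) ^ 3 + 1001 * (N + a) ^ 2 * N + 1287 * (N + a) * N ^ 2 + 195 * N ^ 3 := by
  ring


end Summit.ABC.ABC.Theorems.TowerFourSubLiouville.Negative
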